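import Literature.Computability.Complexity.FoldBricks
import Literature.Computability.Complexity.ListFoldBricks
import HarnessLib

/-!
# List-fold checks: truth of combined one-bit tests, the chain test and the distinctness test over coded lists

Trunk `CplxCore`, continuing `ListFoldBricks.lean` (the fold `Brick.foldFn step ini` of an `FP`
step over the items of a coded list `encList [a₀, …, aₖ₋₁]`, with `Brick.allFn`/`anyFn`/`orFn`)
and `BrickAlgebra.lean` (`andFn`, `notFn`, `OneBit`). A certificate verifier assembled from
one-bit bricks is analysed through statements "`brick input = [1] ↔ property`"; this file adds

* the **truth lemmas** of the connectives and basic tests: `andFn_eq_true_iff`,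
  `orFn_eq_true_iff`, `notFn_eq_true_iff`, `eqPairFn_boolPair_eq_true`, `isNilFn_eq_true_iff`,
  `allFn_boolPair_eq_true`, `anyFn_boolPair_eq_true`, and `oneBit_eqPairFn` (twins of the first
  three and of the last live in `QuantumComplexity/PrattMachine.lean` / `FactoringNP.lean`, on
  top of developments that the toolkit cannot import; hoisted here);
* the bridge `frames_eq_encList` / `listBool_encode_eq_encList` between Mathlib's
  `Encoding.listBool` codes (`EncodingFrames.listBool_encode_eq`: header, separator, `frames`)
  and the toolkit's `encList` (twin: `ShorFP.listBool_encode_eq_encList`, `Cryptography/`), and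
  `encodeNat_inj`;
* two further folds on `Brick.foldFn`, each with its value on coded lists, `OneBit`, and
  membership in `FP`:
  **`Brick.chainFn c`** — on `⟨x, L⟩`, the bit "consecutive items `a, b` of `L` satisfy
  `c ⟨x, ⟨a, b⟩⟩ = [1]`", i.e. `List.IsChain` (`chainFn_encList_eq_true`; accumulator
  `⟨previous item, flag⟩`, the first item fed as the initial `prev` by `chainPre`);
  **`Brick.nodupFn`** — on `⟨x, L⟩`, the bit "the items of `L` are pairwise distinct",
  `List.Nodup` (`nodupFn_encList_eq_true`; accumulator `⟨items read so far, flag⟩`, membership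
  by `anyFn eqPairFn`, growth `FoldGrowth 7`).

First user: the `#P`-membership verifier of self-avoiding walks,
`Literature/Barriers/CriticalPhenomena/GridSAWCountingVerifier.lean`.

## References

* S. Arora, B. Barak, *Computational Complexity: A Modern Approach*, CUP 2009, §1.3 (polynomial
  time is closed under composition and bounded loops), §0.1 (coding of lists).
-/

namespace Literature.Computability.Complexity

open _root_.Computability HashBricks

namespace Brick

/-! ### Truth of combined one-bit conditions -/

/-- Truth of a conjunction of one-bit conditions. [folklore] -/
theorem andFn_eq_true_iff {c d : List Bool → List Bool} (hc : OneBit c) (hd : OneBit d) (z : List Bool) :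
    andFn c d z = [true] ↔ c z = [true] ∧ d z = [true] := by
  obtain ⟨b, hb⟩ := hc z; obtain ⟨b', hb'⟩ := hd z
  rw [andFn_apply hb hb', hb, hb']; cases b <;> cases b' <;> simp

/-- Truth of a disjunction of one-bit conditions. [folklore] -/
theorem orFn_eq_true_iff {c d : List Bool → List Bool} (hc : OneBit c) (hd : OneBit d) (z : List Bool) :
    orFn c d z = [true] ↔ c z = [true] ∨ d z = [true] := by
  obtain ⟨b, hb⟩ := hc z; obtain ⟨b', hb'⟩ := hd z
  rw [orFn_apply hb hb', hb, hb']; cases b <;> cases b' <;> simp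

/-- Truth of a negated one-bit condition. [folklore] -/
theorem notFn_eq_true_iff {c : List Bool → List Bool} (hc : OneBit c) (z : List Bool) :
    notFn c z = [true] ↔ ¬ c z = [true] := by
  obtain ⟨b, hb⟩ := hc z
  rw [notFn_apply hb, hb]; cases b <;> simp

/-- Truth of the string equality test on a pair. [folklore] -/
theorem eqPairFn_boolPair_eq_true (a b : List Bool) : eqPairFn (boolPair a b) = [true] ↔ a = b := by
  rw [eqPairFn_boolPair]; simp

/-- Truth of `isNilFn`. [folklore] -/
theorem isNilFn_eq_true_iff (w : List Bool) : isNilFn w = [true] ↔ w = [] := by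
  simp [isNilFn]

/-- Truth of `allFn` on a pair. [folklore] -/
theorem allFn_boolPair_eq_true {c : List Bool → List Bool} (hc : OneBit c) (x L : List Bool) :
    allFn c (boolPair x L) = [true] ↔ ∀ a ∈ decNil L, c (boolPair x a) = [true] := by
  rw [allFn_boolPair hc]; simp

/-- Truth of `anyFn` on a pair. [folklore] -/
theorem anyFn_boolPair_eq_true {c : List Bool → List Bool} (hc : OneBit c) (x L : List Bool) :
    anyFn c (boolPair x L) = [true] ↔ ∃ a ∈ decNil L, c (boolPair x a) = [true] := by
  rw [anyFn_boolPair hc]; simp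

/-- `eqPairFn` is one-bit (twin: `QuantumComplexity.oneBit_eqPairFn` in `FactoringNP.lean`, on top of
the factoring development; hoisted into the toolkit). [folklore] -/
theorem oneBit_eqPairFn : OneBit eqPairFn := fun w => by
  rcases eqPairFn_eq_or w with h | h <;> exact ⟨_, h⟩

/-- The framed code of `EncodingFrames.lean` is the list code `encList`. [folklore] -/
theorem frames_eq_encList (l : List (List Bool)) : frames l = encList l := by
  induction l with
  | nil => rfl
  | cons a l ih => rw [frames_cons_eq_boolPair, ih, encList_cons]

/-- A `listBool` code is the unary length paired with the list code of the item codes.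
[cite: AroraBarak2009, §0.1 (coding of tuples and lists)] -/
theorem listBool_encode_eq_encList {α : Type} (e : Encoding α Bool) (l : List α) :
    e.listBool.encode l = boolPair (unaryEncodeNat l.length) (encList (l.map e.encode)) := by
  show boolPair _ (l.foldr _ []) = _
  rw [foldr_boolPair_eq, frames_eq_encList]

/-- `encodeNat` is injective (as an iff; twins: `WordRAM.ToTM2.encodeNat_eq_encodeNat_iff` in
`Cryptography/WordRAMToTM2Memory.lean`, `encodeNat_injective` in `Cryptography/QuantumCircuit.lean` —
not importable into the toolkit). [folklore] -/
theorem encodeNat_inj {m n : ℕ} : encodeNat m = encodeNat n ↔ m = n :=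
  ⟨fun h => by simpa using congrArg decodeNat h, fun h => h ▸ rfl⟩

/-! ### `chainFn`: consecutive items pass a one-bit test -/

/-- The step of `chainFn` on step arguments `⟨w', ⟨item, ⟨prev, flag⟩⟩⟩` with `w' = ⟨⟨x, a₀⟩, L⟩`:
the new accumulator `⟨item, [flag ∧ c ⟨x, ⟨prev, item⟩⟩]⟩`. [folklore] -/
noncomputable def chainStep (c : List Bool → List Bool) : List Bool → List Bool :=
  fanoutFn (fstF ∘ sndF)
    (andFn (headBitFn ∘ sndF ∘ sndPow 1)
      (c ∘ fanoutFn (fstF ∘ fstF ∘ fstF) (fanoutFn (fstF ∘ sndPow 1) (fstF ∘ sndF))))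

/-- `chainStep c ∈ FP` for `c ∈ FP`. [folklore] -/
theorem chainStep_mem_FP {c : List Bool → List Bool} (hc : c ∈ FP) : chainStep c ∈ FP :=
  fanoutFn_mem_FP (comp_mem_FP fstF_mem_FP sndF_mem_FP)
    (andFn_mem_FP (comp_mem_FP headBitFn_mem_FP (comp_mem_FP sndF_mem_FP (sndPow_mem_FP 1)))
      (comp_mem_FP hc (fanoutFn_mem_FP (comp_mem_FP fstF_mem_FP (comp_mem_FP fstF_mem_FP fstF_mem_FP))
        (fanoutFn_mem_FP (comp_mem_FP fstF_mem_FP (sndPow_mem_FP 1)) (comp_mem_FP fstF_mem_FP sndF_mem_FP)))))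

/-- Value of the step. [folklore] -/
theorem chainStep_apply {c : List Bool → List Bool} (hc : OneBit c) (x a₀ L item prev : List Bool)
    (b : Bool) : chainStep c (boolPair (boolPair (boolPair x a₀) L) (boolPair item (boolPair prev [b]))) =
      boolPair item [b && (c (boolPair x (boolPair prev item))).headD false] := by
  set Z := boolPair (boolPair (boolPair x a₀) L) (boolPair item (boolPair prev [b])) with hZ
  have h1 : (fstF ∘ sndF) Z = item := by simp [hZ]
  have h2 : (headBitFn ∘ sndF ∘ sndPow 1) Z = [b] := by simp [hZ, sndPow]
  obtain ⟨b', hb'⟩ := hc (boolPair x (boolPair prev item))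
  have h3 : (c ∘ fanoutFn (fstF ∘ fstF ∘ fstF) (fanoutFn (fstF ∘ sndPow 1) (fstF ∘ sndF))) Z = [b'] := by
    simp only [Function.comp_apply, fanoutFn_apply, hZ, fstF_boolPair, sndF_boolPair, sndPow]
    exact hb'
  rw [chainStep, fanoutFn_apply, h1, andFn_apply h2 h3, hb']
  rfl

/-- Growth of the step: `FoldGrowth 3`. [folklore] -/
theorem foldGrowth_chainStep {c : List Bool → List Bool} (hc : OneBit c) : FoldGrowth 3 (chainStep c) := by
  intro v
  have hand : (andFn (headBitFn ∘ sndF ∘ sndPow 1)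
      (c ∘ fanoutFn (fstF ∘ fstF ∘ fstF) (fanoutFn (fstF ∘ sndPow 1) (fstF ∘ sndF))) v).length = 1 :=
    (oneBit_andFn (oneBit_headBitFn.comp _) (hc.comp _)).length_eq v
  rw [chainStep, fanoutFn_apply, length_boolPair, hand, Function.comp_apply]
  omega

/-- The initial accumulator of `chainFn` on `w' = ⟨⟨x, a₀⟩, L⟩`: `⟨a₀, [1]⟩`. [folklore] -/
noncomputable def chainIni : List Bool → List Bool := fanoutFn (sndF ∘ fstF) fun _ => [true]

/-- `chainIni ∈ FP`. [folklore] -/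
theorem chainIni_mem_FP : chainIni ∈ FP :=
  fanoutFn_mem_FP (comp_mem_FP sndF_mem_FP fstF_mem_FP) (const_mem_FP _)

/-- The re-arrangement `⟨x, L⟩ ↦ ⟨⟨x, fst L⟩, snd L⟩` feeding the first item as the initial
`prev`. [folklore] -/
noncomputable def chainPre : List Bool → List Bool :=
  fanoutFn (fanoutFn fstF (fstF ∘ sndF)) (sndF ∘ sndF)

/-- `chainPre ∈ FP`. [folklore] -/
theorem chainPre_mem_FP : chainPre ∈ FP :=
  fanoutFn_mem_FP (fanoutFn_mem_FP fstF_mem_FP (comp_mem_FP fstF_mem_FP sndF_mem_FP))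
    (comp_mem_FP sndF_mem_FP sndF_mem_FP)

/-- **`chainFn c`**: on `⟨x, L⟩`, the bit "consecutive items `a`, `b` of the coded list `L`
satisfy `c ⟨x, ⟨a, b⟩⟩ = [1]`" (`List.IsChain`). [cite: AroraBarak2009, §1.3 (bounded loops)] -/
noncomputable def chainFn (c : List Bool → List Bool) : List Bool → List Bool :=
  headBitFn ∘ sndF ∘ foldFn (chainStep c) chainIni ∘ chainPre

/-- `chainFn c ∈ FP` for a one-bit `c ∈ FP`. [folklore] -/
theorem chainFn_mem_FP {c : List Bool → List Bool} (hFP : c ∈ FP) (hc : OneBit c) : chainFn c ∈ FP :=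
  comp_mem_FP headBitFn_mem_FP (comp_mem_FP sndF_mem_FP (comp_mem_FP
    (foldFn_mem_FP (chainStep_mem_FP hFP) chainIni_mem_FP (foldGrowth_chainStep hc)) chainPre_mem_FP))

/-- `chainFn c` is one-bit. [folklore] -/
theorem oneBit_chainFn (c : List Bool → List Bool) : OneBit (chainFn c) := oneBit_headBitFn.comp _

/-- The left fold of the chain step. [folklore] -/
theorem foldl_chainStep {c : List Bool → List Bool} (hc : OneBit c) (x a₀ L : List Bool) :
    ∀ (l : List (List Bool)) (prev : List Bool) (b : Bool),
      l.foldl (fun acc a => chainStep c (boolPair (boolPair (boolPair x a₀) L) (boolPair a acc)))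
          (boolPair prev [b]) =
        boolPair (l.getLastD prev)
          [b && decide (List.IsChain (fun p q => c (boolPair x (boolPair p q)) = [true]) (prev :: l))]
  | [], prev, b => by simp
  | a :: l, prev, b => by
    rw [List.foldl_cons, chainStep_apply hc, foldl_chainStep hc x a₀ L l]
    obtain ⟨b', hb'⟩ := hc (boolPair x (boolPair prev a))
    simp only [hb', List.headD_cons, List.getLastD_cons, List.isChain_cons_cons, Bool.and_assoc]
    congr 2
    cases b' <;> simp

/-- **Truth of `chainFn` on a coded list.** [cite: AroraBarak2009, §1.3] -/
theorem chainFn_encList_eq_true {c : List Bool → List Bool} (hc : OneBit c) (x : List Bool)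
    (l : List (List Bool)) : chainFn c (boolPair x (encList l)) = [true] ↔
      List.IsChain (fun p q => c (boolPair x (boolPair p q)) = [true]) l := by
  rw [chainFn, Function.comp_apply, Function.comp_apply, Function.comp_apply]
  have hpre : chainPre (boolPair x (encList l)) =
      boolPair (boolPair x (fstF (encList l))) (sndF (encList l)) := by simp [chainPre]
  rw [hpre, foldFn_boolPair]
  have hini : chainIni (boolPair (boolPair x (fstF (encList l))) (sndF (encList l))) =
      boolPair (fstF (encList l)) [true] := by simp [chainIni]
  rw [hini]
  cases l with
  | nil => simp [fstF, sndF, boolUnpair]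
  | cons a l =>
    rw [encList_cons, fstF_boolPair, sndF_boolPair, decNil_encList, foldl_chainStep hc]
    simp

/-! ### `nodupFn`: the items are pairwise distinct -/

/-- The step of `nodupFn` on step arguments `⟨w, ⟨item, ⟨seen, flag⟩⟩⟩`: the new accumulator
`⟨⟨item, seen⟩, [flag ∧ item ∉ seen]⟩` (`seen` is the coded list of the items read so far, most
recent first; membership by `anyFn eqPairFn`). [folklore] -/
noncomputable def nodupStep : List Bool → List Bool :=
  fanoutFn (fanoutFn (fstF ∘ sndF) (fstF ∘ sndPow 1))
    (andFn (headBitFn ∘ sndF ∘ sndPow 1)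
      (notFn (anyFn eqPairFn ∘ fanoutFn (fstF ∘ sndF) (fstF ∘ sndPow 1))))

/-- `nodupStep ∈ FP`. [folklore] -/
theorem nodupStep_mem_FP : nodupStep ∈ FP :=
  fanoutFn_mem_FP (fanoutFn_mem_FP (comp_mem_FP fstF_mem_FP sndF_mem_FP) (comp_mem_FP fstF_mem_FP (sndPow_mem_FP 1)))
    (andFn_mem_FP (comp_mem_FP headBitFn_mem_FP (comp_mem_FP sndF_mem_FP (sndPow_mem_FP 1)))
      (notFn_mem_FP (comp_mem_FP (anyFn_mem_FP eqPairFn_mem_FP oneBit_eqPairFn)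
        (fanoutFn_mem_FP (comp_mem_FP fstF_mem_FP sndF_mem_FP) (comp_mem_FP fstF_mem_FP (sndPow_mem_FP 1))))))

/-- Value of the step on a coded `seen` list. [folklore] -/
theorem nodupStep_apply (w item : List Bool) (seen : List (List Bool)) (b : Bool) :
    nodupStep (boolPair w (boolPair item (boolPair (encList seen) [b]))) =
      boolPair (boolPair item (encList seen))
        [b && !decide (∃ a ∈ seen, eqPairFn (boolPair item a) = [true])] := by
  set Z := boolPair w (boolPair item (boolPair (encList seen) [b])) with hZ
  have h1 : (fanoutFn (fstF ∘ sndF) (fstF ∘ sndPow 1)) Z = boolPair item (encList seen) := by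
    simp [hZ, sndPow]
  have h2 : (headBitFn ∘ sndF ∘ sndPow 1) Z = [b] := by simp [hZ, sndPow]
  have h3 : (anyFn eqPairFn ∘ fanoutFn (fstF ∘ sndF) (fstF ∘ sndPow 1)) Z =
      [decide (∃ a ∈ seen, eqPairFn (boolPair item a) = [true])] := by
    simp only [Function.comp_apply, fanoutFn_apply, hZ, fstF_boolPair, sndF_boolPair, sndPow]
    rw [anyFn_boolPair oneBit_eqPairFn, decNil_encList]
  rw [nodupStep, fanoutFn_apply, h1, andFn_apply h2 (notFn_apply h3)]

/-- Growth of the step: `FoldGrowth 7`. [folklore] -/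
theorem foldGrowth_nodupStep : FoldGrowth 7 nodupStep := by
  intro v
  have hand : (andFn (headBitFn ∘ sndF ∘ sndPow 1)
      (notFn (anyFn eqPairFn ∘ fanoutFn (fstF ∘ sndF) (fstF ∘ sndPow 1))) v).length = 1 :=
    (oneBit_andFn (oneBit_headBitFn.comp _) (oneBit_notFn ((oneBit_anyFn oneBit_eqPairFn).comp _))).length_eq v
  have e1 : sndPow 1 v = sndF (sndF v) := rfl
  rw [nodupStep, fanoutFn_apply, length_boolPair, fanoutFn_apply, length_boolPair, hand]
  simp only [Function.comp_apply, e1]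
  have := length_fstF_sndF_le (sndF (sndF v))
  omega

/-- **`nodupFn`**: on `⟨x, L⟩` (the context `x` is ignored), the bit "the items of the coded
list `L` are pairwise distinct" (`List.Nodup`). [cite: AroraBarak2009, §1.3 (bounded loops)] -/
noncomputable def nodupFn : List Bool → List Bool :=
  headBitFn ∘ sndF ∘ foldFn nodupStep (fun _ => boolPair [] [true])

/-- `nodupFn ∈ FP`. [folklore] -/
theorem nodupFn_mem_FP : nodupFn ∈ FP :=
  comp_mem_FP headBitFn_mem_FP (comp_mem_FP sndF_mem_FP
    (foldFn_mem_FP nodupStep_mem_FP (const_mem_FP _) foldGrowth_nodupStep))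

/-- `nodupFn` is one-bit. [folklore] -/
theorem oneBit_nodupFn : OneBit nodupFn := oneBit_headBitFn.comp _

/-- The left fold of the distinctness step: `seen` collects the items read (most recent first),
the flag whether they are pairwise distinct and outside the initial `seen`. [folklore] -/
theorem foldl_nodupStep (w : List Bool) : ∀ (l seen : List (List Bool)) (b : Bool),
    l.foldl (fun acc a => nodupStep (boolPair w (boolPair a acc))) (boolPair (encList seen) [b]) =
      boolPair (encList (l.reverse ++ seen)) [b && decide (l.Nodup ∧ ∀ x ∈ l, x ∉ seen)]
  | [], seen, b => by simp
  | a :: l, seen, b => by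
    rw [List.foldl_cons, nodupStep_apply, ← encList_cons, foldl_nodupStep w l (a :: seen),
      Bool.and_assoc]
    have hmem : (∃ c ∈ seen, eqPairFn (boolPair a c) = [true]) ↔ a ∈ seen := by
      simp only [eqPairFn_boolPair_eq_true]
      exact ⟨fun ⟨c, hc, h⟩ => h ▸ hc, fun h => ⟨a, h, rfl⟩⟩
    have key : (!decide (∃ c ∈ seen, eqPairFn (boolPair a c) = [true]) &&
        decide (l.Nodup ∧ ∀ x ∈ l, x ∉ a :: seen)) =
        decide ((a :: l).Nodup ∧ ∀ x ∈ a :: l, x ∉ seen) := by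
      rw [Bool.eq_iff_iff]
      simp only [Bool.and_eq_true, Bool.not_eq_true', decide_eq_false_iff_not, decide_eq_true_eq, hmem]
      constructor
      · rintro ⟨ha, hl, h⟩
        refine ⟨List.nodup_cons.mpr ⟨fun hal => h a hal List.mem_cons_self, hl⟩, fun x hx => ?_⟩
        rcases List.mem_cons.mp hx with rfl | hx
        · exact ha
        · exact fun hs => h x hx (List.mem_cons_of_mem a hs)
      · rintro ⟨hnd, h⟩
        obtain ⟨hal, hl⟩ := List.nodup_cons.mp hnd
        refine ⟨h a List.mem_cons_self, hl, fun x hx hxs => ?_⟩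
        rcases List.mem_cons.mp hxs with rfl | hxs
        · exact hal hx
        · exact h x (List.mem_cons_of_mem a hx) hxs
    rw [key]
    simp [List.reverse_cons, List.append_assoc]

/-- **Truth of `nodupFn` on a coded list.** [cite: AroraBarak2009, §1.3] -/
theorem nodupFn_encList_eq_true (x : List Bool) (l : List (List Bool)) :
    nodupFn (boolPair x (encList l)) = [true] ↔ l.Nodup := by
  have h0 : boolPair [] [true] = boolPair (encList []) [true] := rfl
  rw [nodupFn, Function.comp_apply, Function.comp_apply, foldFn_boolPair, decNil_encList, h0,
    foldl_nodupStep]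
  simp

end Brick

end Literature.Computability.Complexity
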